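import Summits.Schanuel.Schanuel.Theorems.ZilberEacCancellingFibreDensity
import HarnessLib

/-!
# EVERY real plane with positive coefficients: Zariski density of
# `{x₂ = r₀x₀ + r₁x₁ + c, y₀ = x₀ + y₂F₀(y₂), y₁ = x₁ + y₂F₁(y₂)}`, `r₀, r₁ > 0`

Zilber's Exponential-Algebraic Closedness, case ladder (host summit Schanuel, cell `pub-schanuel`,
seat 2, gen 15).  Corollaries of the cancelling-fibre regime (`ZilberEacCancellingFibreDensity`):
for `r₀ > 0`, `r₁ > 0` a small exponent `β` is always admissible, so

* **`unprojectedDense_polyFibredGraph_hyperplane_pos`** — `r₀ > 0`, `r₁ > 0`, one of them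
  irrational, `F₀ ≠ 0`, `F₁` arbitrary, `c ∈ ℂ` ⟹ `I(W ∩ Γ_exp) = I(W)` — whatever the SIZE of the
  fibres: the slow (`(r₀+r₁)eⱼ < 1`, gen 9/12), critical (`= 1`, gen 13/14) and the previously OPEN
  super-critical sizes (`> 1`, O57/O58 (a) of the census) at once;
* **`polyFibredGraph_hyperplane_pos_member_dense`** — all seven hypotheses of `ECCell 3 2`, not
  linearly split, `W ∩ Γ_exp ≠ ∅`, dense;
* examples, both fibres SUPER-CRITICAL (outside every earlier theorem of the cell):
  **`sqrtTwoOneSqCube_member_dense`** `{x₂ = √2x₀ + x₁, y₀ = x₀ + y₂², y₁ = x₁ + y₂³}` and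
  **`sqrtTwoSqrtThreeOne_member_dense`** `{x₂ = √2x₀ + √3x₁ + 1, y₀ = x₀ + y₂, y₁ = x₁ + y₂}`
  (constant fibres of size `m^{√2+√3}` against targets of size `m`).

HONEST FRAMING: explicit families inside an OPEN cell; `EC(3,2)` OPEN; NOT Schanuel's conjecture;
EAC ⇏ SC.
-/

noncomputable section

open Complex MvPolynomial Filter Topology
open Literature.NumberTheory.Transcendental Literature.ModelTheory.Zilber
  Literature.ModelTheory.ExponentialFields

set_option linter.dupNamespace false

namespace Summit.Schanuel.Schanuel.Theorems

section Positive

/-- **THEOREM (every real plane with positive coefficients is dense).**  `r₀ > 0`, `r₁ > 0`, one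
of them irrational, `F₀ ≠ 0`, `F₁` arbitrary, `c ∈ ℂ`:
`W = {x₂ = r₀x₀ + r₁x₁ + c, y₀ = x₀ + y₂F₀(y₂), y₁ = x₁ + y₂F₁(y₂)}` has `I(W ∩ Γ_exp) = I(W)` —
whatever the size of the fibres (slow, critical or super-critical). (new)
[cite: MantovaMasser2023, §1 p.5 (the open case dim π(V) = 2 in ℂ³×ℂˣ³)] -/
theorem unprojectedDense_polyFibredGraph_hyperplane_pos (F : Fin 2 → Polynomial ℂ) (hF0 : F 0 ≠ 0)
    (r₀ r₁ : ℝ) (hr₀ : 0 < r₀) (hr₁ : 0 < r₁) (hirr : Irrational r₀ ∨ Irrational r₁) (c : ℂ) :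
    UnprojectedDense (polyFibredGraph (hyperplanePoly ![r₀, r₁] c) (fun j => X j)
      (fun j => (F j).toMvPolynomial 0)) := by
  refine unprojectedDense_polyFibredGraph_cancelling F hF0 r₀ r₁ hr₀.ne' hirr c ?_
  -- a small `β` is admissible: `β(1/e₀ - r₀) < r₁`
  set e₀ : ℝ := (((F 0).natDegree + 1 : ℕ) : ℝ) with he₀
  set e₁ : ℝ := (((F 1).natDegree + 1 : ℕ) : ℝ) with he₁
  have he₀pos : 0 < e₀ := by rw [he₀]; positivity
  have he₁pos : 0 < e₁ := by rw [he₁]; positivity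
  set β : ℝ := min (e₀ / (2 * e₁)) (r₁ * e₀ / 2) with hβ
  have hβpos : 0 < β := lt_min (by positivity) (by positivity)
  have hβ1 : β ≤ e₀ / (2 * e₁) := min_le_left _ _
  have hβ2 : β ≤ r₁ * e₀ / 2 := min_le_right _ _
  refine ⟨β, hβpos, ?_, ?_⟩
  · calc β * e₁ ≤ e₀ / (2 * e₁) * e₁ := mul_le_mul_of_nonneg_right hβ1 he₁pos.le
      _ = e₀ / 2 := by field_simp
      _ < e₀ := by linarith
  · rw [div_lt_iff₀ hr₀]
    have h1 : β / e₀ ≤ r₁ / 2 := by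
      rw [div_le_iff₀ he₀pos]; linarith
    nlinarith

/-- **Certified members over positive real planes, dense.**  `r₀, r₁ > 0`, one irrational,
`F₀ ≠ 0`, any `F₁`, `c`: all seven hypotheses of `ECCell 3 2`, not linearly split,
`W ∩ Γ_exp ≠ ∅`, `I(W ∩ Γ_exp) = I(W)`. (new)
[cite: MantovaMasser2023, §1 p.5 (the open case dim π(V) = 2 in ℂ³×ℂˣ³)] -/
theorem polyFibredGraph_hyperplane_pos_member_dense (F : Fin 2 → Polynomial ℂ) (hF0 : F 0 ≠ 0)
    (r₀ r₁ : ℝ) (hr₀ : 0 < r₀) (hr₁ : 0 < r₁) (hirr : Irrational r₀ ∨ Irrational r₁) (c : ℂ) :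
    (IsIrreducibleClosed ℂ (polyFibredGraph (hyperplanePoly ![r₀, r₁] c) (fun j => X j)
        (fun j => (F j).toMvPolynomial 0)) ∧
      (polyFibredGraph (hyperplanePoly ![r₀, r₁] c) (fun j => X j) (fun j => (F j).toMvPolynomial 0) ∩
          torusLocus ℂ 3).Nonempty ∧
      IsRotund ℂ 3 (polyFibredGraph (hyperplanePoly ![r₀, r₁] c) (fun j => X j)
          (fun j => (F j).toMvPolynomial 0) ∩ torusLocus ℂ 3) ∧
      IsAddFree ℂ 3 (polyFibredGraph (hyperplanePoly ![r₀, r₁] c) (fun j => X j)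
          (fun j => (F j).toMvPolynomial 0) ∩ torusLocus ℂ 3) ∧
      IsMulFree ℂ 3 (polyFibredGraph (hyperplanePoly ![r₀, r₁] c) (fun j => X j)
          (fun j => (F j).toMvPolynomial 0) ∩ torusLocus ℂ 3) ∧
      zariskiDim ℂ (polyFibredGraph (hyperplanePoly ![r₀, r₁] c) (fun j => X j)
          (fun j => (F j).toMvPolynomial 0)) = (3 : ℕ) ∧
      addProjDim ℂ 3 (polyFibredGraph (hyperplanePoly ![r₀, r₁] c) (fun j => X j)
          (fun j => (F j).toMvPolynomial 0)) = (2 : ℕ)) ∧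
    ¬ IsLinearSplit ℂ 3 (polyFibredGraph (hyperplanePoly ![r₀, r₁] c) (fun j => X j)
        (fun j => (F j).toMvPolynomial 0)) ∧
    (polyFibredGraph (hyperplanePoly ![r₀, r₁] c) (fun j => X j) (fun j => (F j).toMvPolynomial 0) ∩
        expGraph ℂ 3).Nonempty ∧
    UnprojectedDense (polyFibredGraph (hyperplanePoly ![r₀, r₁] c) (fun j => X j)
        (fun j => (F j).toMvPolynomial 0)) := by
  have hA : Function.Injective (aeval (fun j : Fin 2 => (X j : MvPolynomial (Fin 2) ℂ)) :
      MvPolynomial (Fin 2) ℂ →ₐ[ℂ] MvPolynomial (Fin 2) ℂ) := by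
    rw [aeval_X_left]; exact fun _ _ h => h
  have hirr' : ∃ i : Fin 2, Irrational ((![r₀, r₁] : Fin 2 → ℝ) i) := by
    rcases hirr with h | h
    · exact ⟨0, by simpa using h⟩
    · exact ⟨1, by simpa using h⟩
  have hcell := ecCell_hypotheses_polyFibredGraph_hyperplane ![r₀, r₁] c (fun j => X j)
    (fun j => (F j).toMvPolynomial 0) hA hirr'
  have hdense := unprojectedDense_polyFibredGraph_hyperplane_pos F hF0 r₀ r₁ hr₀ hr₁ hirr c
  refine ⟨hcell, not_isLinearSplit_polyFibredGraph _ (fun j => X j) _ (by norm_num) hA, ?_, hdense⟩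
  obtain ⟨w, hw, -⟩ := hcell.2.1
  exact inter_expGraph_nonempty_of_vanishingIdeal_eq ⟨w, hw⟩ hdense


/-- **Both fibres super-critical, dense**: `W = {x₂ = √2x₀ + x₁, y₀ = x₀ + y₂², y₁ = x₁ + y₂³}`
(`F₀ = u`, `F₁ = u²`; `(r₀ + r₁)(deg Fⱼ + 1) > 1` for both `j`, so neither the slow nor the critical
theorems apply): all seven hypotheses of `ECCell 3 2`, not linearly split, `W ∩ Γ_exp ≠ ∅`,
`I(W ∩ Γ_exp) = I(W)`. (new)
[cite: MantovaMasser2023, §1 p.5 (the open case dim π(V) = 2 in ℂ³×ℂˣ³)] -/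
theorem sqrtTwoOneSqCube_member_dense :
    let F : Fin 2 → Polynomial ℂ := ![Polynomial.X, Polynomial.X ^ 2]
    let W := polyFibredGraph (hyperplanePoly ![Real.sqrt 2, 1] 0) (fun j => X j)
      (fun j => (F j).toMvPolynomial 0)
    (IsIrreducibleClosed ℂ W ∧ (W ∩ torusLocus ℂ 3).Nonempty ∧ IsRotund ℂ 3 (W ∩ torusLocus ℂ 3) ∧
        IsAddFree ℂ 3 (W ∩ torusLocus ℂ 3) ∧ IsMulFree ℂ 3 (W ∩ torusLocus ℂ 3) ∧
        zariskiDim ℂ W = (3 : ℕ) ∧ addProjDim ℂ 3 W = (2 : ℕ)) ∧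
      ¬ IsLinearSplit ℂ 3 W ∧ (W ∩ expGraph ℂ 3).Nonempty ∧ UnprojectedDense W :=
  polyFibredGraph_hyperplane_pos_member_dense ![Polynomial.X, Polynomial.X ^ 2] (by simp)
    (Real.sqrt 2) 1 (Real.sqrt_pos.2 two_pos) one_pos (Or.inl irrational_sqrt_two) 0

/-- **Constant fibres of super-critical size, dense**:
`W = {x₂ = √2x₀ + √3x₁ + 1, y₀ = x₀ + y₂, y₁ = x₁ + y₂}` (`F₀ = F₁ = 1`, `|y₂| ≍ m^{√2+√3} ≫ |xⱼ|`
along lattice rays — the size at which gen 8's census recorded "the all-fast balance is impossible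
near infinity"): all seven hypotheses of `ECCell 3 2`, not linearly split, `W ∩ Γ_exp ≠ ∅`,
`I(W ∩ Γ_exp) = I(W)`. (new)
[cite: MantovaMasser2023, §1 p.5 (the open case dim π(V) = 2 in ℂ³×ℂˣ³)] -/
theorem sqrtTwoSqrtThreeOne_member_dense :
    let F : Fin 2 → Polynomial ℂ := ![1, 1]
    let W := polyFibredGraph (hyperplanePoly ![Real.sqrt 2, Real.sqrt 3] 1) (fun j => X j)
      (fun j => (F j).toMvPolynomial 0)
    (IsIrreducibleClosed ℂ W ∧ (W ∩ torusLocus ℂ 3).Nonempty ∧ IsRotund ℂ 3 (W ∩ torusLocus ℂ 3) ∧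
        IsAddFree ℂ 3 (W ∩ torusLocus ℂ 3) ∧ IsMulFree ℂ 3 (W ∩ torusLocus ℂ 3) ∧
        zariskiDim ℂ W = (3 : ℕ) ∧ addProjDim ℂ 3 W = (2 : ℕ)) ∧
      ¬ IsLinearSplit ℂ 3 W ∧ (W ∩ expGraph ℂ 3).Nonempty ∧ UnprojectedDense W :=
  polyFibredGraph_hyperplane_pos_member_dense ![1, 1] (by simp)
    (Real.sqrt 2) (Real.sqrt 3) (Real.sqrt_pos.2 two_pos) (Real.sqrt_pos.2 three_pos)
    (Or.inl irrational_sqrt_two) 1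

end Positive

end Summit.Schanuel.Schanuel.Theorems

end
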